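import Summits.BirchSwinnertonDyer.Rank1Residual.Additive.SpecialJTraceForm1728
import HarnessLib

/-!
# `j = 1728` over `𝔽_p`: traces `{±2, ±4}` at `p = 5`, and anomalous reduction only at `p = 5`

HONEST FRAMING (cell `b2b-bsdres`, run/shared/lean/b2b/bsd-rank1-residual/, verbatim in every
file): the goal of the cell is to DELETE the COMBINATION-SHAPED residual classes of the
Birch–Swinnerton-Dyer formula for ALL analytic-rank `≤ 1` elliptic curves over `ℚ` — "full BSD
formula for every rank `≤ 1` curve in class `C`" assembled STRICTLY from published theorems — so
that the rank-`≤ 1` remainder becomes exactly the CONSTRUCTION-SHAPED classes, which are TYPED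
(missing-input `Prop`s), NOT attempted. This is not "finishing BSD". Sub-cell `additive-p2`
(X3♯(G-ord) / X4♯(G-ord)), generation 35, part 2: research route; no claim beyond the stated
classes; theorems only, no definition, no named fact, nothing booked, no label moved.

## What is proved

Consequences of the trace law for `j = 1728` (part 1, `SpecialJTraceForm1728.lean`:
`p + 1 − #E(k) = 2u`, `u² + v² = p` over a field `k` with a prime number `p ≡ 1 (mod 4)` of
elements) for Mazur's anomalous condition `p ∣ #E(k)`:

* `SpecialJ.two_mul_mem_of_sq_add_sq_eq_five` — `u² + v² = 5` ⟹ `2u ∈ {2, −2, 4, −4}`;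
* **`SpecialJ.trace_mem_of_j_eq_of_natCard_eq_five`** — `#k = 5`, `j(E) = 1728`: the trace
  `6 − #E(k)` lies in `{2, −2, 4, −4}`, i.e. **`#E(𝔽_5) ∈ {2, 4, 8, 10}`**
  (`natCard_point_mem_of_j_eq_of_natCard_eq_five`), and **`5 ∣ #E(𝔽_5) ⟺ #E(𝔽_5) = 10`**
  (`five_dvd_natCard_point_iff_of_j_eq`);
* **`SpecialJ.eq_five_and_natCard_point_eq_ten_of_dvd_natCard_point_of_j_eq`** — over a field with a
  prime number `p ≥ 5` of elements, a curve with `j = 1728` is ANOMALOUS (`p ∣ #E(k)`) **only at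
  `p = 5`, and then `#E(𝔽_5) = 10` exactly** (`p ≢ 1 (mod 4)`: supersingular, gen 9's
  `dvd_trace_of_j_eq_of_ringChar_eq`; `p ≡ 1 (mod 4)`: `#E = cp`, `c ≠ 1` gives `p − 1 ≤ −2u`,
  `(p − 1)² ≤ 4u² ≤ 4p`, so `p = 5`, `u = −2`); the iff form `dvd_natCard_point_iff_of_j_eq`, and
  Greenberg's currency `natCard_primaryComponent_point_eq_one_of_j_eq_of_ne` (`#E(𝔽_p)[p^∞] = 1`
  unless `p = 5 ∧ #E = 10`). Gen 11 (`GordNonAnomalousFour`: `p ≥ 7 ⟹ p ∤ #E`, from `2 ∣ #E`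
  alone) and gen 34 (`natCard_point_eq_of_dvd`: anomalous ⟹ `#E(𝔽_p) = p`, `p ≥ 7`) are sharp
  exactly here: at `p = 5` an anomalous `j = 1728` curve has `#E(𝔽_5) = 10 = 2p`;
* **`SpecialJ.intCast_trace_eq_c₄_of_j_eq_of_natCard_eq_five`** — `#k = 5`, `j(E) = 1728`:
  **`6 − #E(k) ≡ c₄(E)` in `k`** (`c₄(E) ∈ k` is a curve invariant since `u⁴ = 1` in `𝔽_5^×`; short
  model: `c₄ = −48a₄ = 2a₄`, trace `≡ C(2,1)a₄` by Euler's criterion, gen 3), so the trace is the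
  element of `{−4, −2, 2, 4}` congruent to `c₄`, and **`#E(𝔽_5) = 10 ⟺ c₄(E) = 1`**
  (`natCard_point_eq_ten_iff_c₄_eq_one_of_j_eq`): over `𝔽_5` the anomalous bit of a `j = 1728`
  curve is ONE residue class of `c₄`.

Census pointer (EVIDENCE, gen 11's `census/anom/anom_census.tsv`, 1280 (G-ord) pairs N < 2·10⁴):
the 233 defect-`4` rows at `p = 5` have `a_𝔭 ∈ {±2, ±4}` (233/233) and are anomalous over the
minimal (G)-field exactly when `a_𝔭 = −4`, i.e. `#Ẽ(𝔽_5) = 10` (70 rows; `#Ẽ(𝔽_5) = 2, 4, 8, 10` on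
`48, 51, 64, 70` rows); the 32 defect-`4` rows at `p ≥ 13` are never anomalous. EVIDENCE ONLY (via gen
34's explicit special fibre `y² = x³ + αx`, `α = −27c₄/(−5)^{v_5(c₄)}`, LAW 4): the 70 anomalous rows
are exactly the rows with `c₄(E)/(−5)^{v_5(c₄)} ≡ 1 (mod 5)`, and `a_𝔭` is the element of `{±2, ±4}`
congruent to that unit (233/233).

References: K. Ireland, M. Rosen, GTM 84 (2nd ed. 1990), Ch. 18 §4 Thm. 5; B. Mazur, Invent. Math.
18 (1972) §5; R. Greenberg, LNM 1716 (1999) Thm. 4.1; J. H. Silverman, *AEC* V.1.1, Ex. V.4.5.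
-/

noncomputable section

open scoped Classical

open WeierstrassCurve Literature.NumberTheory.EllipticCurves

namespace Summit.BirchSwinnertonDyer.Rank1Residual.Additive

namespace SpecialJ

/-! ### The prime `5`: traces `{±2, ±4}`, anomalous iff `#E(𝔽_5) = 10` -/

/-- `u² + v² = 5` in integers forces `2u ∈ {2, −2, 4, −4}` (`(u, v) ∈ {±1} × {±2} ∪ {±2} × {±1}`).
[folklore] -/
theorem two_mul_mem_of_sq_add_sq_eq_five {u v : ℤ} (h : u ^ 2 + v ^ 2 = 5) :
    2 * u = 2 ∨ 2 * u = -2 ∨ 2 * u = 4 ∨ 2 * u = -4 := by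
  have hu : -2 ≤ u ∧ u ≤ 2 := ⟨by nlinarith [sq_nonneg v, sq_nonneg (u + 2)],
    by nlinarith [sq_nonneg v, sq_nonneg (u - 2)]⟩
  have hv : -2 ≤ v ∧ v ≤ 2 := ⟨by nlinarith [sq_nonneg u, sq_nonneg (v + 2)],
    by nlinarith [sq_nonneg u, sq_nonneg (v - 2)]⟩
  obtain ⟨hu1, hu2⟩ := hu
  obtain ⟨hv1, hv2⟩ := hv
  interval_cases u <;> interval_cases v <;> omega

section Five

variable {k : Type*} [Field k] [Finite k] (E : WeierstrassCurve k) [E.IsElliptic]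

/-- **Over a field with `5` elements, a curve with `j = 1728` has trace in `{2, −2, 4, −4}`**
(`6 − #E(k) = 2u`, `u² + v² = 5`). Census (gen 11, defect `4` at `p = 5`): `a ∈ {±2, ±4}` on
233/233 rows. [cite: IrelandRosen1990, Ch. 18 §4, Theorem 5] -/
theorem trace_mem_of_j_eq_of_natCard_eq_five (hcard : Nat.card k = 5) (hj : E.j = 1728) :
    (6 : ℤ) - Nat.card E.toAffine.Point = 2 ∨ (6 : ℤ) - Nat.card E.toAffine.Point = -2 ∨
      (6 : ℤ) - Nat.card E.toAffine.Point = 4 ∨ (6 : ℤ) - Nat.card E.toAffine.Point = -4 := by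
  obtain ⟨u, v, ha, huv⟩ :=
    exists_trace_eq_two_mul_and_sq_add_sq_of_j_eq E (p := 5) (by norm_num) (by norm_num) hcard hj
  have ha' : (6 : ℤ) - Nat.card E.toAffine.Point = 2 * u := by
    rw [← ha]; push_cast; ring
  rw [ha']
  exact two_mul_mem_of_sq_add_sq_eq_five (by exact_mod_cast huv)

/-- **`#E(𝔽_5) ∈ {2, 4, 8, 10}` for `j = 1728`.** [cite: IrelandRosen1990, Ch. 18 §4, Theorem 5] -/
theorem natCard_point_mem_of_j_eq_of_natCard_eq_five (hcard : Nat.card k = 5) (hj : E.j = 1728) :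
    Nat.card E.toAffine.Point = 2 ∨ Nat.card E.toAffine.Point = 4 ∨
      Nat.card E.toAffine.Point = 8 ∨ Nat.card E.toAffine.Point = 10 := by
  rcases trace_mem_of_j_eq_of_natCard_eq_five E hcard hj with h | h | h | h <;> omega

/-- **Anomalous at `5` iff `#E(𝔽_5) = 10`** (`j = 1728`): `5 ∣ #E(𝔽_5) ⟺ #E(𝔽_5) = 10 = 2·5`
(trace `−4`). Census: the `70` anomalous defect-`4` rows at `p = 5` are exactly the rows with
`a_𝔭 = −4`. [cite: IrelandRosen1990, Ch. 18 §4, Theorem 5] -/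
theorem five_dvd_natCard_point_iff_of_j_eq (hcard : Nat.card k = 5) (hj : E.j = 1728) :
    5 ∣ Nat.card E.toAffine.Point ↔ Nat.card E.toAffine.Point = 10 := by
  rcases natCard_point_mem_of_j_eq_of_natCard_eq_five E hcard hj with h | h | h | h <;> rw [h] <;>
    decide

end Five


/-! ### Over `𝔽_5` the trace of a `j = 1728` curve is `c₄` modulo `5` -/

section FiveC4

variable {k : Type*} [Field k] [Finite k] (E : WeierstrassCurve k) [E.IsElliptic]

/-- **Over a field with `5` elements, the trace of a `j = 1728` curve is congruent to its `c₄`:**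
`6 − #E(k) ≡ c₄(E)` in `k`. Here `c₄(E) ∈ k` is an invariant of the curve, not only of the model
(`c₄` changes by `u⁻⁴` and `u⁴ = 1` in `𝔽_5^×`); on the short model `y² = x³ + a₄x` it is
`−48a₄ = 2a₄`, and the trace is `C(2,1)·a₄ = 2a₄` modulo `5` by Euler's criterion (gen 3's
`intCast_trace_eq_neg_sum_pow` + `sum_pow_cubic_of_a₆_eq_zero`: the Hasse-invariant congruence,
Silverman *AEC* V.4.1(a)). With `trace_mem_of_j_eq_of_natCard_eq_five` the trace is therefore the
unique element of `{−4, −2, 2, 4}` congruent to `c₄(E)` (Gauss's congruence `C(2n, n) ≡ 2a` at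
`p = 5`). [cite: IrelandRosen1990, Ch. 18 §4, Theorem 5] -/
theorem intCast_trace_eq_c₄_of_j_eq_of_natCard_eq_five (hcard : Nat.card k = 5) (hj : E.j = 1728) :
    (((6 : ℤ) - Nat.card E.toAffine.Point : ℤ) : k) = E.c₄ := by
  haveI := Fintype.ofFinite k
  obtain ⟨hchar, hq⟩ := ringChar_eq_of_natCard_eq (k := k) (by norm_num : (5 : ℕ).Prime) hcard
  haveI : CharP k 5 := ringChar.of_eq hchar
  obtain ⟨h2, h3⟩ := ringChar_ne_two_and_ne_three (F := k) hchar le_rfl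
  obtain ⟨h2', h3'⟩ := two_ne_zero_and_three_ne_zero h2 h3
  haveI : Invertible (2 : k) := invertibleOfNonzero h2'
  haveI : Invertible (3 : k) := invertibleOfNonzero h3'
  set C := E.toShortNF with hC
  haveI : (C • E).IsShortNF := E.toShortNF_spec
  have hjS : (C • E).j = 1728 := by rw [variableChange_j, hj]
  have hc6 : (C • E).c₆ = 0 := (j_eq_iff_c₆_eq_zero _).mp hjS
  have ha6 : (C • E).a₆ = 0 := by
    rw [(C • E).c₆_of_isShortNF] at hc6
    have h864 : (-864 : k) ≠ 0 := by
      rw [show (-864 : k) = -(2 ^ 5 * 3 ^ 3) by norm_num]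
      exact neg_ne_zero.mpr (mul_ne_zero (pow_ne_zero _ h2') (pow_ne_zero _ h3'))
    exact (mul_eq_zero.mp hc6).resolve_left h864
  have h5 : (5 : k) = 0 := by exact_mod_cast CharP.cast_eq_zero k 5
  -- Euler's criterion on the short model: the trace is `C(2,1)·a₄ = 2a₄` in `k`
  have htr : ((((Fintype.card k : ℤ) + 1 - Nat.card (C • E).toAffine.Point : ℤ)) : k) =
      2 * (C • E).a₄ := by
    rw [intCast_trace_eq_neg_sum_pow (C • E) h2,
      sum_pow_cubic_of_a₆_eq_zero (C • E) h2 ha6 (by omega), neg_neg, hq]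
    norm_num
  -- `c₄` is a model invariant over `𝔽_5` (`u⁴ = 1`) and equals `-48a₄ = 2a₄` on the short model
  have hu4 : ((C.u⁻¹ : kˣ) : k) ^ 4 = 1 := by
    have h := FiniteField.pow_card_sub_one_eq_one ((C.u⁻¹ : kˣ) : k) (Units.ne_zero _)
    rwa [hq] at h
  have hc4 : (C • E).c₄ = E.c₄ := by rw [variableChange_c₄, hu4, one_mul]
  have hc4' : (C • E).c₄ = 2 * (C • E).a₄ := by
    rw [(C • E).c₄_of_isShortNF]
    linear_combination (-10 : k) * (C • E).a₄ * h5
  rw [Nat.card_congr (VariableChange.pointEquiv E C).toEquiv, ← hc4, hc4', ← htr, hq]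
  push_cast
  ring

/-- **Anomalous at `5` iff `c₄ = 1`** (`j = 1728`, `#k = 5`): `#E(k) = 10 ⟺ c₄(E) = 1` in `k`
(the trace is `−4 ≡ 1`; the other classes: `c₄ = 2 ↔ #E = 4`, `c₄ = 3 ↔ #E = 8`, `c₄ = 4 ↔ #E = 2`).
Census (EVIDENCE, via gen 34's explicit special fibre): the 70 anomalous defect-`4` rows at `p = 5`
are exactly the rows with `c₄(E)/(−5)^{v_5(c₄)} ≡ 1 (mod 5)`. [cite: IrelandRosen1990, Ch. 18 §4, Theorem 5] -/
theorem natCard_point_eq_ten_iff_c₄_eq_one_of_j_eq (hcard : Nat.card k = 5) (hj : E.j = 1728) :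
    Nat.card E.toAffine.Point = 10 ↔ E.c₄ = 1 := by
  haveI := Fintype.ofFinite k
  obtain ⟨hchar, -⟩ := ringChar_eq_of_natCard_eq (k := k) (by norm_num : (5 : ℕ).Prime) hcard
  haveI : CharP k 5 := ringChar.of_eq hchar
  have key := intCast_trace_eq_c₄_of_j_eq_of_natCard_eq_five E hcard hj
  have h5 : (5 : k) = 0 := by exact_mod_cast CharP.cast_eq_zero k 5
  have hne : ∀ n : ℕ, 0 < n → n < 5 → (n : k) ≠ 0 := fun n hn hn5 h0 ↦ by
    rw [CharP.cast_eq_zero_iff k 5] at h0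
    exact absurd (Nat.le_of_dvd hn h0) (by omega)
  constructor
  · intro h10
    rw [← key, h10]
    push_cast
    linear_combination -h5
  · intro hc
    rw [hc] at key
    rcases natCard_point_mem_of_j_eq_of_natCard_eq_five E hcard hj with h | h | h | h
    · exfalso
      rw [h] at key; push_cast at key
      exact hne 3 (by norm_num) (by norm_num) (by push_cast; linear_combination key)
    · exfalso
      rw [h] at key; push_cast at key
      exact hne 1 (by norm_num) (by norm_num) (by push_cast; linear_combination key)
    · exfalso
      rw [h] at key; push_cast at key
      exact hne 3 (by norm_num) (by norm_num) (by push_cast; linear_combination -key)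
    · exact h

end FiveC4

/-! ### Anomalous `j = 1728` curves over `𝔽_p` exist only at `p = 5` -/

section Anomalous

variable {k : Type*} [Field k] [Finite k] (E : WeierstrassCurve k) [E.IsElliptic] {p : ℕ}

/-- **ANOMALOUS `j = 1728` CURVES OVER `𝔽_p` (`p ≥ 5`) EXIST ONLY AT `p = 5`, WITH `#E(𝔽_5) = 10`.**
For an elliptic curve `E` over a field `k` with a prime number `p ≥ 5` of elements and
`j(E) = 1728`: if `p ∣ #E(k)` then `p = 5` and `#E(k) = 10`. If `p ≢ 1 (mod 4)` the curve is
supersingular (`p ∣ p + 1 − #E`, gen 9's `dvd_trace_of_j_eq_of_ringChar_eq`), never anomalous; if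
`p ≡ 1 (mod 4)` the trace law gives `p + 1 − #E = 2u`, `u² + v² = p`, and `#E = cp` with `c ≠ 1`
forces `p − 1 ≤ −2u`, `(p − 1)² ≤ 4u² ≤ 4p`, i.e. `p = 5`, `u = −2`, `#E = 10`. Gen 11
(`not_dvd_natCard_point_of_j_eq_of_natCard_eq`, `p ≥ 7`, from `2 ∣ #E` alone) and gen 34
(`natCard_point_eq_of_dvd`: anomalous ⟹ `#E = p` for `p ≥ 7`) are sharp exactly here. Mazur 1972 §5.
[cite: IrelandRosen1990, Ch. 18 §4, Theorem 5] -/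
theorem eq_five_and_natCard_point_eq_ten_of_dvd_natCard_point_of_j_eq (hp : p.Prime)
    (hp5 : 5 ≤ p) (hcard : Nat.card k = p) (hj : E.j = 1728)
    (hdvd : p ∣ Nat.card E.toAffine.Point) : p = 5 ∧ Nat.card E.toAffine.Point = 10 := by
  haveI := Fintype.ofFinite k
  haveI : Fact p.Prime := ⟨hp⟩
  obtain ⟨c, hc⟩ := hdvd
  by_cases hp1 : p % 4 = 1
  · obtain ⟨u, v, ha, huv⟩ := exists_trace_eq_two_mul_and_sq_add_sq_of_j_eq E hp hp1 hcard hj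
    rw [hc] at ha
    push_cast at ha
    -- `p (1 - c) = 2u - 1`
    have key : (p : ℤ) * (1 - c) = 2 * u - 1 := by linear_combination ha
    have hc1 : c ≠ 1 := by
      rintro rfl
      simp only [Nat.cast_one, sub_self, mul_zero] at key
      omega
    have hc0 : c ≠ 0 := by
      rintro rfl
      simp only [Nat.cast_zero, sub_zero, mul_one] at key
      -- `p = 2u - 1`, `u² ≤ p` ⟹ `(u - 1)² ≤ 0`
      nlinarith [sq_nonneg v, sq_nonneg (u - 1), hp.two_le]
    have hc2 : (2 : ℤ) ≤ c := by exact_mod_cast (show 2 ≤ c by omega)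
    have hp0 : (0 : ℤ) ≤ (p : ℤ) - 1 := by linarith [hp.two_le]
    have h1 : (p : ℤ) - 1 ≤ -(2 * u) := by nlinarith
    have h2 : ((p : ℤ) - 1) * ((p : ℤ) - 1) ≤ (-(2 * u)) * (-(2 * u)) :=
      mul_le_mul h1 h1 hp0 (hp0.trans h1)
    have h3 : (-(2 * u)) * (-(2 * u)) ≤ 4 * p := by nlinarith [sq_nonneg v]
    have hp5' : (p : ℤ) ≤ 5 := by nlinarith
    have hp5eq : p = 5 := by omega
    subst hp5eq
    refine ⟨rfl, ?_⟩
    rcases two_mul_mem_of_sq_add_sq_eq_five (by exact_mod_cast huv) with h | h | h | h <;> omega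
  · exfalso
    obtain ⟨hchar, -⟩ := ringChar_eq_of_natCard_eq (k := k) hp hcard
    have h4 : ¬ 4 ∣ p - 1 := by omega
    have hss := dvd_trace_of_j_eq_of_ringChar_eq E hchar hp5 hj h4
    rw [hcard, hc] at hss
    push_cast at hss
    have h1 : (p : ℤ) ∣ 1 := by
      have h : (p : ℤ) ∣ (p : ℤ) + 1 := by
        have h' := dvd_add hss (dvd_mul_right (p : ℤ) (c : ℤ))
        rwa [sub_add_cancel] at h'
      exact dvd_add_self_left.mp h
    have := Int.eq_one_of_dvd_one (by exact_mod_cast Nat.zero_le p) h1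
    have hp1' : p = 1 := by exact_mod_cast this
    exact hp.one_lt.ne' hp1'

/-- **`j = 1728` over `𝔽_p` is anomalous iff `p = 5` and `#E(𝔽_5) = 10`** (`p ≥ 5` prime). Mazur 1972;
Ireland–Rosen Ch. 18 §4 Thm. 5. [cite: IrelandRosen1990, Ch. 18 §4, Theorem 5] -/
theorem dvd_natCard_point_iff_of_j_eq (hp : p.Prime) (hp5 : 5 ≤ p) (hcard : Nat.card k = p)
    (hj : E.j = 1728) :
    p ∣ Nat.card E.toAffine.Point ↔ p = 5 ∧ Nat.card E.toAffine.Point = 10 := by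
  refine ⟨eq_five_and_natCard_point_eq_ten_of_dvd_natCard_point_of_j_eq E hp hp5 hcard hj, ?_⟩
  rintro ⟨rfl, h⟩
  rw [h]
  decide

/-- Greenberg's currency: for `j = 1728` over `𝔽_p`, `p ≥ 5`, the `p`-primary part `#E(𝔽_p)[p^∞]`
is trivial unless `p = 5` and `#E(𝔽_5) = 10`. [cite: GreenbergLNM1716, Thm. 4.1] -/
theorem natCard_primaryComponent_point_eq_one_of_j_eq_of_ne (hp : p.Prime) (hp5 : 5 ≤ p)
    (hcard : Nat.card k = p) (hj : E.j = 1728) (h : p ≠ 5 ∨ Nat.card E.toAffine.Point ≠ 10) :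
    Nat.card (AddCommGroup.primaryComponent E.toAffine.Point p) = 1 := by
  haveI : Fact p.Prime := ⟨hp⟩
  have hnd : ¬ p ∣ Nat.card E.toAffine.Point := by
    rw [dvd_natCard_point_iff_of_j_eq E hp hp5 hcard hj]
    rintro ⟨h1, h2⟩
    rcases h with h | h
    · exact h h1
    · exact h h2
  have hbot : AddCommGroup.primaryComponent E.toAffine.Point p = ⊥ := by
    refine (AddSubgroup.eq_bot_iff_forall _).mpr fun g hg ↦ ?_
    obtain ⟨n, hn⟩ := (AddCommGroup.mem_primaryComponent (G := E.toAffine.Point) (p := p)).mp hg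
    have h1 : addOrderOf g ∣ p ^ n := addOrderOf_dvd_of_nsmul_eq_zero hn
    have h2 : addOrderOf g ∣ Nat.card E.toAffine.Point := addOrderOf_dvd_natCard g
    have hcop : Nat.Coprime (p ^ n) (Nat.card E.toAffine.Point) :=
      Nat.Coprime.pow_left n ((Nat.Prime.coprime_iff_not_dvd hp).mpr hnd)
    have h3 : addOrderOf g ∣ 1 := by
      rw [← hcop.gcd_eq_one]
      exact Nat.dvd_gcd h1 h2
    exact AddMonoid.addOrderOf_eq_one_iff.mp (Nat.dvd_one.mp h3)
  rw [hbot, AddSubgroup.card_bot]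

end Anomalous

end SpecialJ

end Summit.BirchSwinnertonDyer.Rank1Residual.Additive

end
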